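import Summits.BirchSwinnertonDyer.BirchSwinnertonDyer.Theorems.CMKolyvaginAtInertTwoEntangledAtTwoPow
import HarnessLib

/-!
# Route `CMKolyvaginAtInertTwo`, crux `CMKolyvaginExactAtInertTwo` (stmt-BirchSwinnertonDyer-24277):
# KOLYVAGIN'S ANNIHILATOR AT `p = 2` WITHOUT ENTANGLEMENT HYPOTHESIS — `2^{2M₀+2}·Sel_{2^M}(E/K) ⊆ ℤ·δ(y_K)`
# (the entanglement defect is at most `M₀`)

Seat `bsd-line-cmk2-p1` g7 (cell `bsd-print-cf2`); helper (`--supports stmt-BirchSwinnertonDyer-24277`).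
THEOREMS ONLY: no definition, no named fact, no `sorry`; no item is closed; BSD is not proved by this.

The `ε`-part carries, class by class, an entanglement defect `m − b` (p622318, p624071). THIS FILE BOUNDS
IT: if `ord δ(y_K) = 2^{a+1}` EXACTLY (`2^a y_K ∉ 2^M E(K)` and `2^{a+1} y_K ∈ 2^M E(K)`, i.e.
`a + 1 = M − M₀` with `2^{M₀} ∥ y_K`), then for an `ε`-eigen `t ∈ Sel_{2^M}(E/K)` with minimal relation
`2^m t = 2^b β' δy_K` the order of `t` is `2^{m + a + 1 − b} ≤ 2^M`, so `m − b ≤ M − a − 1 = M₀`. Hence,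
producing the minimal relation by `Nat.find` and splitting `β` mod `2^{a+1}` into `2^b·odd`:

* `exists_two_pow_smul_eq_zsmul_plus_uncond` — **every `t ∈ Sel_{2^M}(E/K)` with `c_* t = ε t` has
  `2^{(M−a)+(M−a−1)}·t ∈ ℤ·δ(y_K)`** (= `2^{2M₀+1}`);
* `exists_two_pow_smul_eq_zsmul_uncond` — **every `s ∈ Sel_{2^M}(E/K)` has `2^{(M−a)+(M−a−1)+1}·s ∈
  ℤ·δ(y_K)`** (= `2^{2M₀+2}`): KOLYVAGIN'S THEOREM AT `2` FOR THE HABITAT AS AN ANNIHILATOR, granted the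
  machine's two inputs at `2` (ty2 data) and the Cartan-type element (`hcomm`). Consequences (not drawn
  here): `E(K) ⊗ ℤ₂` has rank `≤ 1` beyond `ℤ y_K` and `Ш(E/K)[2^∞]` has exponent `≤ 2^{2M₀+2}`. For
  `M₀ = 0` (`y_K ∉ 2E(K)`): **`4·Sel_{2^M}(E/K) ⊆ ℤ·δ(y_K)` for every `M`**.

HONEST FRAMING. Exponent `2M₀ + 2` versus the ORDER `4^{M₀}` of the crux: an annihilator, not a count;
the `τ`-invariant order-`2` classes remain invisible (memo §1), so nothing here bounds `#Ш(E/K)[2]`.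
At odd `p` the same argument gives `p^{M₀}` (no defect, no lost bits). Hypotheses at `2` not in print:
ty2's data (p601266), `hcomm`. References: [McCallumLMS1991] §1 Theorem (Kolyvagin), §5 Lemma 5.1,
Thm. 5.4; [GrossLMS1991] Thm. 1.3, Props. 2.1, 2.3; [Kolyvagin1989Izv] Thm. B; memo + KERNEL-STATUS v6.
-/

-- single-conjunct summit: `Summit.BirchSwinnertonDyer.BirchSwinnertonDyer.…` repeats the name by design
set_option linter.dupNamespace false
set_option autoImplicit false

noncomputable section

open scoped Classical
open WeierstrassCurve NumberField IsDedekindDomain Field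
open Literature.NumberTheory.GaloisRepresentations Literature.NumberTheory.EllipticCurves

namespace Summit.BirchSwinnertonDyer.BirchSwinnertonDyer.Theorems.KolyvaginDescentTwo

/-- In an additive commutative group: if `2 d = 0` and `β` is odd then `β • d = d`. [folklore] -/
theorem odd_zsmul_of_two_zsmul_eq_zero {G : Type*} [AddCommGroup G] {d : G} (h2 : ((2 : ℕ) : ℤ) • d = 0)
    {β : ℤ} (hβ : Odd β) : β • d = d := by
  obtain ⟨k, rfl⟩ := hβ
  have h2' : (2 : ℤ) • d = 0 := by exact_mod_cast h2
  rw [add_zsmul, mul_comm, mul_zsmul, h2', zsmul_zero, zero_add, one_zsmul]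

variable (W : WeierstrassCurve ℚ) {K : Type} [Field K] [NumberField K]

set_option maxHeartbeats 800000 in
/-- **The `ε`-part without entanglement hypothesis**: for `t ∈ Sel_{2^M}(E/K)` with `c_* t = ε t`,
granted `ord δ(y_K) = 2^{a+1}` exactly (`2^M Q ≠ 2^a P` for all `Q`, and `2^M Q₀ = 2^{a+1} P` for some
`Q₀`), the machine's inputs at `(2, M)` and `hcomm`: `2^{(M−a)+(M−a−1)}·t = r·δ(y_K)` for some `r`.
[cite: McCallumLMS1991, §1 Theorem (Kolyvagin), §5 Lemma 5.1, Thm. 5.4] [cite: GrossLMS1991, Props. 2.1, 2.3] -/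
theorem exists_two_pow_smul_eq_zsmul_plus_uncond {N : ℕ} [NeZero N]
    [W.IsElliptic] (hK : IsImaginaryQuadratic K) {P : (W.baseChange K).toAffine.Point}
    (hP : IsHeegnerPoint N W K P) (hnt : ¬ IsOfFinAddOrder P)
    (hρ : W.HasSurjectiveModNGaloisRep 2) (hΔ : W.Δ < 0) (hΔK : ¬ IsSquare (W.baseChange K).Δ)
    {c : K ≃ₐ[ℚ] K} (hc : c ≠ 1) {M : ℕ} (hM : 1 ≤ M) {z : absoluteGaloisGroup K}
    (hzfix : ∀ T : geomTorsion (W.baseChange K) ((2 : ℕ) : ℤ), z • T = T → T = 0)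
    (hcomm : ∀ π ∈ torsionFixing (W.baseChange K) ((2 : ℕ) : ℤ),
      ∀ T : geomTorsion (W.baseChange K) ((2 ^ M : ℕ) : ℤ), π • z • T = z • π • T)
    {a : ℕ} (ha : a < M)
    (hy : ∀ Q : (W.baseChange K).toAffine.Point, ((2 ^ M : ℕ) : ℤ) • Q ≠ ((((2 : ℕ) : ℤ) ^ a)) • P)
    (hye : ∃ Q : (W.baseChange K).toAffine.Point, ((2 ^ M : ℕ) : ℤ) • Q = ((((2 : ℕ) : ℤ) ^ (a + 1))) • P)
    {ε : ℤ} (hε : ε = 1 ∨ ε = -1)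
    (hPε : IsOfFinAddOrder (Affine.Point.map (W' := W) (c : K →ₐ[ℚ] K) P - ε • P))
    (D : Rank1Residual.P2.KolyvaginMachine.PointSystemFamily N W K P 2 fun _ ↦ True)
    (R : Rank1Residual.P2.KolyvaginMachine.ReciprocityFamily N W K 2 fun _ ↦ True)
    (hdiv : ∀ Q : geomPoints (W.baseChange K), ∃ R, ((2 ^ M : ℕ) : ℤ) • R = Q)
    {t : galH1Torsion (W.baseChange K) ((2 ^ M : ℕ) : ℤ)}
    (ht : t ∈ selmerGroup (W.baseChange K) ((2 ^ M : ℕ) : ℤ))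
    (htε : conjAct W c ((2 ^ M : ℕ) : ℤ) t = ε • t) :
    ∃ r : ℤ, (((2 : ℕ) : ℤ) ^ ((M - a) + (M - a - 1))) • t =
      r • kummerMapTorsion (W.baseChange K) _ hdiv P := by
  set δP := kummerMapTorsion (W.baseChange K) _ hdiv P with hδP
  have hqkill : ∀ y : galH1Torsion (W.baseChange K) ((2 ^ M : ℕ) : ℤ), (((2 : ℕ) : ℤ) ^ M) • y = 0 :=
    fun y ↦ by rw [← Nat.cast_pow]; exact zsmul_galH1Torsion_eq_zero (W.baseChange K) _ y
  -- `ord δP = 2^{a+1}` exactly: `2^{a+1} δP = 0`, `2^a δP ≠ 0`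
  have hc0 : (((2 : ℕ) : ℤ) ^ (a + 1)) • δP = 0 := by
    obtain ⟨Q, hQ⟩ := hye
    rw [hδP, ← map_zsmul, ← hQ, map_zsmul]
    exact zsmul_galH1Torsion_eq_zero (W.baseChange K) _ _
  have hca : (((2 : ℕ) : ℤ) ^ a) • δP ≠ 0 := by
    intro h0
    have hker : (((2 : ℕ) : ℤ) ^ a) • P ∈ (kummerMapTorsion (W.baseChange K) _ hdiv).ker := by
      rw [AddMonoidHom.mem_ker, map_zsmul, ← hδP, h0]
    rw [kummerMapTorsion_ker, AddMonoidHom.mem_range] at hker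
    obtain ⟨R, hR⟩ := hker
    exact hy R hR
  have h2d : ((2 : ℕ) : ℤ) • ((((2 : ℕ) : ℤ) ^ a) • δP) = 0 := by rw [smul_smul, ← pow_succ', hc0]
  -- the minimal relation `2^m t ∈ ℤ δP`
  have hex : ∃ j : ℕ, ∃ γ : ℤ, (((2 : ℕ) : ℤ) ^ j) • t = γ • δP := ⟨M, 0, by rw [zero_zsmul, hqkill]⟩
  set m := Nat.find hex with hm
  obtain ⟨β, hβ⟩ : ∃ γ : ℤ, (((2 : ℕ) : ℤ) ^ m) • t = γ • δP := Nat.find_spec hex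
  have hmM : m ≤ M := Nat.find_min' hex ⟨0, by rw [zero_zsmul, hqkill]⟩
  have hmin : ∀ (j : ℕ) (γ : ℤ), j < m → (((2 : ℕ) : ℤ) ^ j) • t ≠ γ • δP :=
    fun j γ hj h ↦ Nat.find_min hex hj ⟨γ, h⟩
  -- padding: from `2^{M-a+k} t ∈ ℤδP` with `k ≤ M - a - 1` to the stated exponent
  have hpad : ∀ k : ℕ, k ≤ M - a - 1 →
      (∃ r : ℤ, (((2 : ℕ) : ℤ) ^ (M - a + k)) • t = r • δP) →
      ∃ r : ℤ, (((2 : ℕ) : ℤ) ^ ((M - a) + (M - a - 1))) • t = r • δP := by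
    rintro k hk ⟨r, hr⟩
    refine ⟨(((2 : ℕ) : ℤ) ^ (M - a - 1 - k)) * r, ?_⟩
    rw [show (M - a) + (M - a - 1) = (M - a - 1 - k) + (M - a + k) by omega, pow_add, ← smul_smul, hr,
      smul_smul]
  -- reduce `β` modulo `2^{a+1}`
  set q : ℤ := ((2 : ℕ) : ℤ) ^ (a + 1) with hq
  have hq0 : 0 < q := by positivity
  set β₀ : ℤ := β % q with hβ₀
  have hβ₀rel : (((2 : ℕ) : ℤ) ^ m) • t = β₀ • δP := by
    rw [hβ₀, hβ]
    conv_lhs => rw [← Int.emod_add_ediv_mul β q]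
    rw [add_zsmul, ← smul_smul, hc0, zsmul_zero, add_zero]
  have hβ₀nn : 0 ≤ β₀ := Int.emod_nonneg _ hq0.ne'
  have hβ₀lt : β₀ < q := Int.emod_lt_of_pos _ hq0
  by_cases hzero : β₀ = 0
  · -- `2^m t = 0 = (2^m·0) δP`: the entangled lemma with `b = m`, `β' = 0` (defect `0`)
    have hrel : (((2 : ℕ) : ℤ) ^ m) • t = ((((2 : ℕ) : ℤ) ^ m) * 0) • δP := by
      rw [mul_zero, ← hzero]; exact hβ₀rel
    exact hpad (m - m) (by omega) (exists_two_pow_smul_eq_zsmul_of_entangled W hK hP hnt hρ hΔ hΔK hc hM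
      hzfix hcomm ha hy hε hPε D R hdiv ht htε le_rfl hrel hmin)
  · -- `β₀ = 2^b β''` with `β''` odd, `b ≤ a`
    have hβ₀pos : 0 < β₀ := lt_of_le_of_ne hβ₀nn (Ne.symm hzero)
    obtain ⟨b, n', hodd', hbn⟩ := Nat.exists_eq_two_pow_mul_odd (n := β₀.toNat)
      (fun h0 ↦ by have := Int.toNat_eq_zero.mp h0; omega)
    set β'' : ℤ := (n' : ℤ) with hβ''
    have hodd : Odd β'' := by rw [hβ'']; exact hodd'.natCast
    have hβ₀eq : β₀ = (((2 : ℕ) : ℤ) ^ b) * β'' := by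
      have : (β₀.toNat : ℤ) = β₀ := Int.toNat_of_nonneg hβ₀nn
      rw [← this, hbn]; push_cast; ring
    have hba : b ≤ a := by
      by_contra hlt
      have hle : a + 1 ≤ b := by omega
      have h1 : q ≤ β₀ := by
        rw [hβ₀eq, hq]
        have hn'1 : (1 : ℤ) ≤ β'' := by
          rw [hβ'']; exact_mod_cast Nat.pos_of_ne_zero (fun h ↦ by simp [h] at hodd')
        calc ((2 : ℕ) : ℤ) ^ (a + 1) ≤ ((2 : ℕ) : ℤ) ^ b := pow_le_pow_right₀ (by norm_num) hle
          _ = ((2 : ℕ) : ℤ) ^ b * 1 := (mul_one _).symm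
          _ ≤ ((2 : ℕ) : ℤ) ^ b * β'' := by gcongr
      omega
    rw [hβ₀eq] at hβ₀rel
    by_cases hbm : m ≤ b
    · -- `t' = t - 2^{b-m} β'' δP` is killed by `2^m` with the same minimality: defect `0` for `t'`
      obtain ⟨hδS, hδε⟩ := kummerMapTorsion_mem_selmerGroup_and_conjAct W hnt hc hM hdiv hε hPε D
      set lam : ℤ := (((2 : ℕ) : ℤ) ^ (b - m)) * β'' with hlam
      set t' := t - lam • δP with ht'
      have ht'S : t' ∈ selmerGroup (W.baseChange K) ((2 ^ M : ℕ) : ℤ) :=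
        sub_mem ht (AddSubgroup.zsmul_mem _ hδS _)
      have ht'ε : conjAct W c ((2 ^ M : ℕ) : ℤ) t' = ε • t' := by
        rw [ht', map_sub, map_zsmul, htε, hδε, zsmul_sub, smul_comm lam ε]
      have hrel' : (((2 : ℕ) : ℤ) ^ m) • t' = ((((2 : ℕ) : ℤ) ^ m) * 0) • δP := by
        rw [mul_zero, zero_zsmul, ht', zsmul_sub, hβ₀rel, smul_smul, hlam, ← mul_assoc, ← pow_add,
          show m + (b - m) = b by omega, sub_self]
      have hmin' : ∀ (j : ℕ) (γ : ℤ), j < m → (((2 : ℕ) : ℤ) ^ j) • t' ≠ γ • δP := by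
        intro j γ' hj hj'
        apply hmin j (γ' + (((2 : ℕ) : ℤ) ^ j) * lam) hj
        rw [add_zsmul, ← hj', ht', zsmul_sub, smul_smul, sub_add_cancel]
      obtain ⟨r, hr⟩ := exists_two_pow_smul_eq_zsmul_of_entangled W hK hP hnt hρ hΔ hΔK hc hM hzfix hcomm
        ha hy hε hPε D R hdiv ht'S ht'ε le_rfl hrel' hmin'
      refine hpad (m - m) (by omega) ⟨r + (((2 : ℕ) : ℤ) ^ (M - a + (m - m))) * lam, ?_⟩
      rw [add_zsmul, ← hr, ht', zsmul_sub, smul_smul, sub_add_cancel]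
    · -- the entangled case `b < m`: defect `m - b ≤ M - a - 1`
      have hbm' : b ≤ m := by omega
      have hdef : m - b ≤ M - a - 1 := by
        -- `0 = 2^M t = 2^{M-m} 2^b β'' δP`; if `M - m + b ≤ a` then `2^a β'' δP = 0`, absurd
        by_contra hlt
        have hle : M - m + b ≤ a := by omega
        have h0 : ((((2 : ℕ) : ℤ) ^ (M - m + b)) * β'') • δP = 0 := by
          have e : (((2 : ℕ) : ℤ) ^ (M - m + b)) * β'' =
              ((2 : ℕ) : ℤ) ^ (M - m) * ((((2 : ℕ) : ℤ) ^ b) * β'') := by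
            rw [show M - m + b = (M - m) + b by omega, pow_add]; ring
          rw [e, ← smul_smul, ← hβ₀rel, smul_smul, ← pow_add, show M - m + m = M by omega, hqkill]
        apply hca
        obtain ⟨d, hd⟩ := Nat.exists_eq_add_of_le hle
        have h1 : ((((2 : ℕ) : ℤ) ^ a) * β'') • δP = 0 := by
          rw [hd, add_comm, pow_add, mul_assoc, ← smul_smul, h0, zsmul_zero]
        rw [mul_comm, ← smul_smul, odd_zsmul_of_two_zsmul_eq_zero h2d hodd] at h1
        exact h1
      exact hpad (m - b) hdef (exists_two_pow_smul_eq_zsmul_of_entangled W hK hP hnt hρ hΔ hΔK hc hM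
        hzfix hcomm ha hy hε hPε D R hdiv ht htε hbm' hβ₀rel hmin)

/-- **KOLYVAGIN'S ANNIHILATOR AT `p = 2`, NO ENTANGLEMENT HYPOTHESIS**: with `ord δ(y_K) = 2^{a+1}`
exactly (`a + 1 = M − M₀`), the machine's inputs at `(2, M)` and `hcomm`, **every `s ∈ Sel_{2^M}(E/K)`
has `2^{(M−a)+(M−a−1)+1}·s = r·δ(y_K)`** (`= 2^{2M₀+2}`; for `M₀ = 0`: `4·s ∈ ℤ·δ(y_K)`).
[cite: McCallumLMS1991, §1 Theorem (Kolyvagin), §5] [cite: GrossLMS1991, Thm. 1.3, Props. 2.1, 2.3] -/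
theorem exists_two_pow_smul_eq_zsmul_uncond {N : ℕ} [NeZero N]
    [W.IsElliptic] (hK : IsImaginaryQuadratic K) {P : (W.baseChange K).toAffine.Point}
    (hP : IsHeegnerPoint N W K P) (hnt : ¬ IsOfFinAddOrder P)
    (hρ : W.HasSurjectiveModNGaloisRep 2) (hΔ : W.Δ < 0) (hΔK : ¬ IsSquare (W.baseChange K).Δ)
    {c : K ≃ₐ[ℚ] K} (hc : c ≠ 1) {M : ℕ} (hM : 1 ≤ M) {z : absoluteGaloisGroup K}
    (hzfix : ∀ T : geomTorsion (W.baseChange K) ((2 : ℕ) : ℤ), z • T = T → T = 0)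
    (hcomm : ∀ π ∈ torsionFixing (W.baseChange K) ((2 : ℕ) : ℤ),
      ∀ T : geomTorsion (W.baseChange K) ((2 ^ M : ℕ) : ℤ), π • z • T = z • π • T)
    {a : ℕ} (ha : a < M)
    (hy : ∀ Q : (W.baseChange K).toAffine.Point, ((2 ^ M : ℕ) : ℤ) • Q ≠ ((((2 : ℕ) : ℤ) ^ a)) • P)
    (hye : ∃ Q : (W.baseChange K).toAffine.Point, ((2 ^ M : ℕ) : ℤ) • Q = ((((2 : ℕ) : ℤ) ^ (a + 1))) • P)
    {ε : ℤ} (hε : ε = 1 ∨ ε = -1)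
    (hPε : IsOfFinAddOrder (Affine.Point.map (W' := W) (c : K →ₐ[ℚ] K) P - ε • P))
    (D : Rank1Residual.P2.KolyvaginMachine.PointSystemFamily N W K P 2 fun _ ↦ True)
    (R : Rank1Residual.P2.KolyvaginMachine.ReciprocityFamily N W K 2 fun _ ↦ True)
    (hdiv : ∀ Q : geomPoints (W.baseChange K), ∃ R, ((2 ^ M : ℕ) : ℤ) • R = Q)
    {s : galH1Torsion (W.baseChange K) ((2 ^ M : ℕ) : ℤ)}
    (hs : s ∈ selmerGroup (W.baseChange K) ((2 ^ M : ℕ) : ℤ)) :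
    ∃ r : ℤ, (((2 : ℕ) : ℤ) ^ ((M - a) + (M - a - 1) + 1)) • s =
      r • kummerMapTorsion (W.baseChange K) _ hdiv P := by
  haveI : Algebra.IsQuadraticExtension ℚ K := ⟨hK.1⟩
  haveI : IsTotallyComplex K := hK.2
  have hcard : Nat.card (K ≃ₐ[ℚ] K) = 2 := by rw [IsGalois.card_aut_eq_finrank, hK.1]
  have hcc : c * c = 1 := by
    have h := pow_card_eq_one' (G := K ≃ₐ[ℚ] K) (x := c)
    rwa [hcard, pow_two] at h
  have hεε : ε * ε = 1 := by rcases hε with rfl | rfl <;> norm_num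
  set sp := s + ε • conjAct W c ((2 ^ M : ℕ) : ℤ) s with hsp
  have hspS : sp ∈ selmerGroup (W.baseChange K) ((2 ^ M : ℕ) : ℤ) :=
    add_mem hs (AddSubgroup.zsmul_mem _
      (conjAct_mem_selmerGroup W (fun w ↦ IsTotallyComplex.isComplex w) c _ hs) ε)
  have hspε : conjAct W c ((2 ^ M : ℕ) : ℤ) sp = ε • sp := by
    rw [hsp, map_add, map_zsmul, conjAct_conjAct_of_mul_self W hcc, zsmul_add, smul_smul, hεε,
      one_zsmul, add_comm]
  obtain ⟨r, hr⟩ := exists_two_pow_smul_eq_zsmul_plus_uncond W hK hP hnt hρ hΔ hΔK hc hM hzfix hcomm ha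
    hy hye hε hPε D R hdiv hspS hspε
  have hminus := two_pow_smul_sub_conjAct_eq_zero_of_families_two_pow W hK hP hnt hρ hΔ hΔK hc hM
    hzfix hcomm ha hy hε hPε D R s hs
  refine ⟨r, ?_⟩
  have e2 : (((2 : ℕ) : ℤ) ^ ((M - a) + (M - a - 1))) • sp +
        (((2 : ℕ) : ℤ) ^ (M - a - 1)) • ((((2 : ℕ) : ℤ) ^ (M - a)) • (s - ε • conjAct W c ((2 ^ M : ℕ) : ℤ) s)) =
      (((2 : ℕ) : ℤ) ^ ((M - a) + (M - a - 1) + 1)) • s := by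
    rw [smul_smul, ← pow_add, show M - a - 1 + (M - a) = (M - a) + (M - a - 1) by omega, ← zsmul_add, hsp,
      show s + ε • conjAct W c ((2 ^ M : ℕ) : ℤ) s + (s - ε • conjAct W c ((2 ^ M : ℕ) : ℤ) s) =
        ((2 : ℕ) : ℤ) • s by rw [show (((2 : ℕ) : ℤ)) = 2 by norm_num, two_zsmul]; abel,
      smul_smul, ← pow_succ]
  rw [← e2, hr, hminus, zsmul_zero, add_zero]

end Summit.BirchSwinnertonDyer.BirchSwinnertonDyer.Theorems.KolyvaginDescentTwo

end
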